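import Summits.BirchSwinnertonDyer.BirchSwinnertonDyer.Theorems.ResidualThetaTransportAtTwoSignedMuSeedAtTwoPlusTiltTranslation
import Summits.BirchSwinnertonDyer.BirchSwinnertonDyer.Theorems.ResidualThetaTransportAtTwoSignedMuSeedAtTwoPlusSmoothingCoboundaryPrecision
import HarnessLib

/-!
# Smoothing coboundary VII — `[β] ≡ [u] (mod t^{qʲ})` for `β ≡ u (mod πʲ)` (Lubin–Tate, reduced modulo `π`), hence the
# class-series translate congruence `η(β)·G_χ∘[u] ≡ G_χ + Φ_β (mod t^{qʲ})` of card (D)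
# (seed crux `SignedMuSeedAtTwoPlus` stmt-BirchSwinnertonDyer-21438; parent Kμ⁺ stmt-BirchSwinnertonDyer-20689, route
# ResidualThetaTransportAtTwo; line card `Cruxes/SignedMuSeedAtTwoPlus/Lines/smoothing-coboundary.md`, (D) «for `u ∈ ℤ₄ˣ` and
# odd `β ≡ u (mod 2^k)`, `[β] ≡ [u]` to order `4^k` because `[2](T) = T⁴ + …`, so `G_χ∘[u] ≡ η(β)⁻¹(G_χ + Φ_β) (mod T^{4^k})`»)

Cell `bsd-wall`, width seat `bsd-wall-rtt-p4-w2` g15 (`--supports`, closes nothing).  THEOREMS ONLY; BSD is not proved by this.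

On top of `…TiltTranslation` (w2 g10: `[πʲw]‾ = ([w]‾)^{qʲ}`, `[1 + πʲw]‾ = t ⊕ ([w]‾t)^{qʲ}`) and `…TiltFormalGroup`
(`F = z₁ + z₀·η(z₁) + z₀²·H`), for every Weierstrass curve / Lubin–Tate datum:

* `exists_formalGroupLaw_subst_pair_eq` — the two-variable translation shape `F(A, B) = B + η(B)·A + A²·r` for `A(0) = B(0) = 0`
  (generalises `Tilt.exists_translate_eq`, which is `B = t`);
* **`coeff_formalGroupLaw_subst_pair`** — `A ≡ 0 (mod t^N) ⟹ F(A, B) ≡ B (mod t^N)`;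
* `map_hom_add_pow_mul` — `[u + πʲw]‾ = F̄([u]‾, ([w]‾)^{qʲ})` (Lubin–Tate law), and `map_hom_add_pow_mul_formalGroupLaw` —
  the same with the chord–tangent law of a Weierstrass model `U` (`U.formalGroupLaw = F_f`) in the argument order `F̄(y, [u]‾)`;
* **`coeff_map_hom_add_pow_mul`** — `[u + πʲw]‾ ≡ [u]‾ (mod t^{qʲ})`: the card's «`[β] ≡ [u]` to order `4^k`» (`q = 4`, `j = k`);
* **`classSeries_translate_congr`** — with `…Precision.mahler_translate_congr_mod`: if `η·G∘[u + πʲw]‾ − G = Φ` then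
  `η·G∘[u]‾ ≡ G + Φ (mod t^{qʲ})` — every `ℤ₄ˣ`-translate of the class series is affine in it modulo `t^{4^k}`.

[folklore]
-/

noncomputable section

set_option autoImplicit false
-- the Theorems namespace of this sub repeats the summit name by design (D-0017 nested layout)
set_option linter.dupNamespace false

open PowerSeries
open Literature.NumberTheory.GaloisRepresentations

namespace Summit.BirchSwinnertonDyer.BirchSwinnertonDyer.Theorems.SignedMuAtTwo.SmoothingCoboundary

section FormalGroup

variable {k : Type*} [CommRing k] (W : WeierstrassCurve k)

/-- A pair of one-variable series without constant terms is substitutable. [folklore] -/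
theorem hasSubst_pair' {A B : PowerSeries k} (hA : constantCoeff A = 0) (hB : constantCoeff B = 0) :
    MvPowerSeries.HasSubst ![A, B] :=
  MvPowerSeries.hasSubst_of_constantCoeff_zero fun i => by
    fin_cases i
    · exact hA
    · exact hB

/-- **Two-variable translation shape**: `F(A, B) = B + η(B)·A + A²·r` for `A(0) = B(0) = 0` (from the `z₀`-adic expansion
`F = z₁ + z₀·η(z₁) + z₀²·H` of `…TiltFormalGroup`). [folklore] -/
theorem exists_formalGroupLaw_subst_pair_eq {A B : PowerSeries k} (hA : constantCoeff A = 0)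
    (hB : constantCoeff B = 0) :
    ∃ r : PowerSeries k,
      MvPowerSeries.subst ![A, B] W.formalGroupLaw = B + W.formalEta.subst B * A + A ^ 2 * r := by
  obtain ⟨H, hH⟩ := Tilt.X_zero_sq_dvd_formalGroupLaw_sub W
  have hs := hasSubst_pair' hA hB
  refine ⟨MvPowerSeries.subst ![A, B] H, ?_⟩
  have hF : W.formalGroupLaw = MvPowerSeries.X 1 +
      MvPowerSeries.X 0 * W.formalEta.subst (MvPowerSeries.X 1 : MvPowerSeries (Fin 2) k) +
      MvPowerSeries.X 0 ^ 2 * H := by rw [← hH]; ring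
  have hη : MvPowerSeries.subst ![A, B]
      (W.formalEta.subst (MvPowerSeries.X 1 : MvPowerSeries (Fin 2) k)) = W.formalEta.subst B := by
    rw [Literature.NumberTheory.EllipticCurves.mvSubst_powerSeries_subst (PowerSeries.HasSubst.X 1) hs,
      MvPowerSeries.subst_X hs]
    rfl
  conv_lhs => rw [hF]
  rw [← MvPowerSeries.coe_substAlgHom hs]
  simp only [map_add, map_mul, map_pow, MvPowerSeries.substAlgHom_X]
  rw [MvPowerSeries.coe_substAlgHom hs, hη]
  simp only [Matrix.cons_val_zero, Matrix.cons_val_one]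
  ring

/-- **Translation by a deep element does not move low coefficients**: `A ≡ 0 (mod t^N)` (and `A(0) = B(0) = 0`)
⟹ `F(A, B) ≡ B (mod t^N)`. [folklore] -/
theorem coeff_formalGroupLaw_subst_pair {A B : PowerSeries k} (hA0 : constantCoeff A = 0)
    (hB : constantCoeff B = 0) {N : ℕ} (hA : ∀ i < N, coeff i A = 0) :
    ∀ n < N, coeff n (MvPowerSeries.subst ![A, B] W.formalGroupLaw) = coeff n B := by
  obtain ⟨r, hr⟩ := exists_formalGroupLaw_subst_pair_eq W hA0 hB
  obtain ⟨g, hg⟩ := (PowerSeries.X_pow_dvd_iff (n := N) (φ := A)).mpr hA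
  intro n hn
  have e : MvPowerSeries.subst ![A, B] W.formalGroupLaw
      = B + X ^ N * (W.formalEta.subst B * g + X ^ N * g ^ 2 * r) := by
    rw [hr, hg]; ring
  rw [e, map_add, coeff_X_pow_mul', if_neg (by omega), add_zero]

end FormalGroup

section LubinTate

variable {A : Type*} [CommRing A] {π : A} {q : ℕ} (hA : LubinTate.IsLTRing π q) {f : PowerSeries A}
  (hf : LubinTate.IsLTSeries π q f)

/-- `[a]‾` has no constant term. [folklore] -/
theorem constantCoeff_map_hom (a : A) :
    constantCoeff ((LubinTate.hom hA hf hf a).map (Ideal.Quotient.mk (Ideal.span {π}))) = 0 := by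
  rw [Tilt.constantCoeff_map', LubinTate.constantCoeff_hom, map_zero]

/-- **`[u + πʲ·w]‾ = F̄([u]‾, ([w]‾)^{qʲ})`** (Lubin–Tate law reduced modulo `π`; `[a + b] = F([a], [b])`,
`[πʲw]‾ = ([w]‾)^{qʲ}`). [folklore] -/
theorem map_hom_add_pow_mul (j : ℕ) (u w : A) :
    (LubinTate.hom hA hf hf (u + π ^ j * w)).map (Ideal.Quotient.mk (Ideal.span {π})) =
      MvPowerSeries.subst ![(LubinTate.hom hA hf hf u).map (Ideal.Quotient.mk (Ideal.span {π})),
          ((LubinTate.hom hA hf hf w).map (Ideal.Quotient.mk (Ideal.span {π}))) ^ (q ^ j)]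
        ((LubinTate.ltF hA hf).map (Ideal.Quotient.mk (Ideal.span {π}))) := by
  have hs : MvPowerSeries.HasSubst ![LubinTate.hom hA hf hf u, LubinTate.hom hA hf hf (π ^ j * w)] :=
    MvPowerSeries.hasSubst_of_constantCoeff_zero fun i => by
      fin_cases i
      · exact LubinTate.constantCoeff_hom' hA hf hf u
      · exact LubinTate.constantCoeff_hom' hA hf hf (π ^ j * w)
  rw [LubinTate.hom_add]
  change MvPowerSeries.map _ (MvPowerSeries.subst _ _) = _
  rw [MvPowerSeries.map_subst hs]
  congr 1
  funext i
  fin_cases i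
  · rfl
  · exact Tilt.map_hom_pow_mul hA hf j w

/-- The same with the chord–tangent law of a Weierstrass model `U/A` whose formal group law IS `F_f` (the RTT files'
`formalGroupLaw_eq_ltF'`), in the argument order `F̄(y, [u]‾)`, `y = ([w]‾)^{qʲ}`, of `…TiltFormalGroup`. [folklore] -/
theorem map_hom_add_pow_mul_formalGroupLaw (U : WeierstrassCurve A) (hU : U.formalGroupLaw = LubinTate.ltF hA hf)
    (j : ℕ) (u w : A) :
    (LubinTate.hom hA hf hf (u + π ^ j * w)).map (Ideal.Quotient.mk (Ideal.span {π})) =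
      MvPowerSeries.subst ![((LubinTate.hom hA hf hf w).map (Ideal.Quotient.mk (Ideal.span {π}))) ^ (q ^ j),
          (LubinTate.hom hA hf hf u).map (Ideal.Quotient.mk (Ideal.span {π}))]
        (U.map (Ideal.Quotient.mk (Ideal.span {π}))).formalGroupLaw := by
  set y := ((LubinTate.hom hA hf hf w).map (Ideal.Quotient.mk (Ideal.span {π}))) ^ (q ^ j) with hy
  set B := (LubinTate.hom hA hf hf u).map (Ideal.Quotient.mk (Ideal.span {π})) with hB
  have hy0 : constantCoeff y = 0 := Tilt.constantCoeff_pow_map_hom hA hf j w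
  have hB0 : constantCoeff B = 0 := constantCoeff_map_hom hA hf u
  rw [map_hom_add_pow_mul hA hf j u w, ← hU, WeierstrassCurve.map_formalGroupLaw]
  set W := U.map (Ideal.Quotient.mk (Ideal.span {π})) with hW
  have hsBy : MvPowerSeries.HasSubst ![B, y] := hasSubst_pair' hB0 hy0
  conv_lhs => rw [← W.formalGroupLaw_comm']
  rw [MvPowerSeries.subst_comp_subst_apply
    (WeierstrassCurve.hasSubst_X_pair (R := A ⧸ Ideal.span {π}) 1 0) hsBy]
  congr 1
  funext i
  fin_cases i
  · exact MvPowerSeries.subst_X hsBy 1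
  · exact MvPowerSeries.subst_X hsBy 0

/-- **`[u + πʲw]‾ ≡ [u]‾ (mod t^{qʲ})`** — the card's «for `β ≡ u (mod 2^k)`, `[β] ≡ [u]` to order `4^k`, because
`[2](T) = T⁴ + …`» (here: any Lubin–Tate datum `(A, π, q, f)` with a Weierstrass model, reduced modulo `π`). [folklore] -/
theorem coeff_map_hom_add_pow_mul (U : WeierstrassCurve A) (hU : U.formalGroupLaw = LubinTate.ltF hA hf)
    (j : ℕ) (u w : A) :
    ∀ n < q ^ j, coeff n ((LubinTate.hom hA hf hf (u + π ^ j * w)).map (Ideal.Quotient.mk (Ideal.span {π}))) =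
      coeff n ((LubinTate.hom hA hf hf u).map (Ideal.Quotient.mk (Ideal.span {π}))) := by
  have hXw : (X : PowerSeries (A ⧸ Ideal.span {π})) ∣
      (LubinTate.hom hA hf hf w).map (Ideal.Quotient.mk (Ideal.span {π})) :=
    X_dvd_iff.mpr (constantCoeff_map_hom hA hf w)
  have hy : ∀ i < q ^ j,
      coeff i (((LubinTate.hom hA hf hf w).map (Ideal.Quotient.mk (Ideal.span {π}))) ^ (q ^ j)) = 0 :=
    (PowerSeries.X_pow_dvd_iff).mp (pow_dvd_pow_of_dvd hXw (q ^ j))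
  rw [map_hom_add_pow_mul_formalGroupLaw hA hf U hU j u w]
  exact coeff_formalGroupLaw_subst_pair _ (Tilt.constantCoeff_pow_map_hom hA hf j w)
    (constantCoeff_map_hom hA hf u) hy

/-- **The class-series translate congruence of card (D)**: if `η·G∘[β]‾ − G = Φ` with `β = u + πʲw` then
`η·G∘[u]‾ ≡ G + Φ (mod t^{qʲ})` (`…Precision.mahler_translate_congr_mod` + `coeff_map_hom_add_pow_mul`). In the card:
`A = ℤ₄`, `π = −2`, `q = 4`, `u ∈ ℤ₄ˣ`, `β` odd global with `β ≡ u (mod 2^k)`, `η = η(β)`, `Φ = Φ_β`. [folklore] -/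
theorem classSeries_translate_congr (U : WeierstrassCurve A) (hU : U.formalGroupLaw = LubinTate.ltF hA hf)
    (j : ℕ) (u w : A) (η : A ⧸ Ideal.span {π}) {G Φ : PowerSeries (A ⧸ Ideal.span {π})}
    (hG : η • G.subst ((LubinTate.hom hA hf hf (u + π ^ j * w)).map (Ideal.Quotient.mk (Ideal.span {π}))) - G = Φ) :
    ∀ n < q ^ j, coeff n (η • G.subst ((LubinTate.hom hA hf hf u).map (Ideal.Quotient.mk (Ideal.span {π})))) =
      coeff n (G + Φ) :=
  mahler_translate_congr_mod η (constantCoeff_map_hom hA hf (u + π ^ j * w)) (constantCoeff_map_hom hA hf u)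
    (coeff_map_hom_add_pow_mul hA hf U hU j u w) hG

end LubinTate

end Summit.BirchSwinnertonDyer.BirchSwinnertonDyer.Theorems.SignedMuAtTwo.SmoothingCoboundary
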